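import Summits.NavierStokesRegularity.FluidComputer.PalasekTowerRegisterGlobalHalvesAt

/-!
# REGISTER v2.3′: the BALL LEVER on the conclusion side — heredity as typed confines every later readout to
# EVERY ball that confines the design and holds the earlier readouts (re-balling `S ↦ {S with radius := r}`)

Cell `ns-blowup`, seat `ns-blowup-fc-prover-3` (g4; D-0074 GROUP C/E «BRIDGE SUPPORT»; bears_on LADDER-NS N1,
route `PalasekTowerBreakdown`, child cruxes stmt-NavierStokesRegularity-19249 `HeredityAtOne` (registered stubs
`stub_apriori_ceiling_at_one` / `stub_readout_floors_one`), -19250 `HeredityFromTwo`, parent -19178 — supported,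
NOT closed or claimed). Companion of `PalasekTowerRegisterGlobal.lean` (p411629: `Margins.routeG`, the items of
record), `PalasekTowerRegisterGlobalHeredity.lean` (p415576: `HeredityAt k`, `HeredityFrom k₀`, `HeredityAtOne`),
`PalasekTowerRegisterGlobalHalvesAt.lean` (p422702: `ReadoutFloorsAt k`) and
`PalasekTowerHeredityWitnessUnconditional.lean` (`Stage.velocity_eq'`, `Stage.velocity_eq_of_classical`: W14-free
uniqueness of the registered flow). LABEL: E–C typing (KERNEL: one schedule transformer, two bookkeeping predicates,
their transport lemmas, and PROVED consequences of the OPEN `∀`-statements; no named fact, no `sorry`). WHAT THIS IS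
NOT: not Navier–Stokes evidence — no stage, flow or tower is constructed or claimed; `HeredityAt k`, `HeredityAtOne`,
`HeredityFrom k₀`, `EpisodeInductionG`, `ReadoutFloorsAt k` appear only as HYPOTHESES of implications (or negated in
the conclusion of refutation TEMPLATES whose premise is one EXHIBITED registered stage — none is known: vacuity
stands).

## The lever (refuter K49 (B) recorded the transformer; here it is applied to the CONCLUSION of heredity)

The register's ball `B̄(0, S.radius)` is SCHEDULE DATA. It enters a pinned, rigid, quiet design in exactly four
places: `Pins.datum_confined` / `Pins.force_confined` (datum and force vanish outside the ball; here
`Schedule.ConfinedTo S r`), and the three READOUT clauses of a `routeG` stage — the velocity floor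
`∃ x, ‖x‖ ≤ radius ∧ c₁ Y_j ≤ ‖u (τ j) x‖` (`Stage.floor`), the strain floor (`Margins.withStrain`) and the core
ledger (`CoreLedger`: the core ball's centre has `‖x‖ ≤ radius`); here the three together are
`Schedule.ReadsIn S j r v` for the slice `v = u (τ j)`. It does NOT enter `Rigid`, `Quiet`, the ceilings, the quiet
clauses, the global anchor (`Schedule.AnchorGlobal` is radius-free since v2.3′), the energy or the PDE. Hence
(§1–§2): for every `r` such that `B̄(0, r)` still confines `(u₀, f)` and the levels `j ≤ k` of a registered stage
`s` are still read inside it, the re-balled schedule `S.reball r := {S with radius := r}` is again pinned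
(`Λ = 8`, `θ = 6/5`), rigid and quiet, and `s` is again a globally anchored registered stage of it
(`Stage.reball`). `HeredityAt k` quantifies over ALL pinned rigid quiet wide schedules, so it applies to
`S.reball r` — and its conclusion reads level `k + 1` INSIDE `B̄(0, r)`. Since the registered flow of a design is
unique on every slab (`Stage.velocity_eq'`, W14-free), this gives (§3):

**`HeredityAt.readsIn_reball`.** Under `HeredityAt k`, EVERY registered level-`(k+1)` stage of a pinned rigid
quiet wide design reads level `k + 1` at `τ (k+1)` (speed `≥ c₁ Y_{k+1}`, strain `≥ c₁ A_{k+1}`, an `N_{k+1}`-core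
loop) inside EVERY ball `B̄(0, r)`, `r ≤ radius`, that confines `(u₀, f)` and in which the levels `j ≤ k` are read
— in particular inside the SMALLEST such ball; cumulatively (`HeredityFrom.readsIn_all`), under
`EpisodeInductionG = HeredityFrom 1` THE WHOLE TOWER of every registered stage is read inside every ball that
confines the design and reads levels `0` and `1`. The register has no pin that keeps a flow's active structure inside,
or returns it to, such a ball (a structure moving at the floor speed `c₁ Y_k` for the rigid window
`c₅ log N_{k+1} / A_k` travels `c₅ log N_{k+1} / N_k ≈ 62 / N_k` on the wide rates — many structure diameters
`1/N_k`): the `∀`-form carries an UNINTENDED GEOMETRIC CONJUNCT. Whether a registered stage violating it exists is as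
open as `EpisodeBaseG`; the templates of §4 say what such a stage must show (stage form; plain-continuation form:
compute the design's flow to `τ (k+1)` — speed `< c₁ Y_{k+1}` on the smallest admissible ball refutes the `∀`-form at
level `k`, by bookkeeping, not by mechanism: MISSTATEMENT class, repair = a level-indexed or conclusion-side radius).
§5: the same lever on the LOWER stub `ReadoutFloorsAt k` (its conclusion carries `S.radius` three times); the UPPER
stub `AprioriCeilingAt k` is radius-free in its conclusion and untouched. The items BY ROUTE-DECL NAME are read in
`Theorems/PalasekTowerBreakdownReball.lean`.

References: S. Palasek, arXiv:2605.13827 §3.3, §4 [cite: Palasek2026ElementaryModel, §3.3]; H. Sohr, *The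
Navier–Stokes Equations*, Birkhäuser 2001, Ch. V Thm. 1.5.1 (weak–strong uniqueness, used through the tree's
`Stage.velocity_eq'`) [cite: Sohr2001, Ch. V Thm. 1.5.1].
-/

noncomputable section

namespace Summit.NavierStokesRegularity.FluidComputer.PalasekTowerClayBridge

open Set MeasureTheory Filter Topology Function Real
open scoped ENNReal ContDiff NNReal
open Literature.Analysis.FluidPDE

/-! ## §1 Re-balling a schedule; confinement and readouts relative to a ball -/

namespace Schedule

variable {R : TowerRates} (S : Schedule R)

/-- **Re-balling**: the schedule `S` with its ball radius replaced by `r`; every other field (blow-up time,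
readout times, constants, datum, force, label loops) is kept. The transformer of refuter K49 (B).
[cite: Palasek2026ElementaryModel, §3.3] -/
def reball (r : ℝ) : Schedule R :=
  { S with radius := r }

/-- The re-balled schedule has the new radius. [folklore] -/
@[simp] theorem reball_radius (r : ℝ) : (S.reball r).radius = r := rfl

/-- Re-balling keeps the readout times. [folklore] -/
@[simp] theorem reball_τ (r : ℝ) : (S.reball r).τ = S.τ := rfl

/-- Re-balling keeps the datum. [folklore] -/
@[simp] theorem reball_u₀ (r : ℝ) : (S.reball r).u₀ = S.u₀ := rfl

/-- Re-balling keeps the force. [folklore] -/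
@[simp] theorem reball_f (r : ℝ) : (S.reball r).f = S.f := rfl

/-- **The design is CONFINED to `B̄(0, r)`**: datum and force vanish outside it (the two radius clauses of
`Schedule.Pins`, at a general radius). [cite: Palasek2026ElementaryModel, §3.3] -/
def ConfinedTo (r : ℝ) : Prop :=
  (∀ x, r < ‖x‖ → S.u₀ x = 0) ∧ (∀ t x, r < ‖x‖ → S.f t x = 0)

/-- **Level `j` is READ inside `B̄(0, r)`** by the velocity slice `v` (for the schedule's floor constant `c₁` and
the rates `R`): the three readout clauses of the register at a general radius — a point of speed `≥ c₁ Y_j`, a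
point of strain `≥ c₁ A_j`, and an `N_j`-core loop (closed `C¹` loop of speed `≤ 8π / N_j` inside a ball of radius
`1 / N_j`, circulation `≥ c₁ N_j^{β-2}`), each centred within distance `r` of the origin.
[cite: Palasek2026ElementaryModel, §3.1] -/
def ReadsIn (j : ℕ) (r : ℝ) (v : EuclideanSpace ℝ (Fin 3) → EuclideanSpace ℝ (Fin 3)) : Prop :=
  (∃ x, ‖x‖ ≤ r ∧ S.c₁ * R.Y j ≤ ‖v x‖) ∧
    (∃ x, ‖x‖ ≤ r ∧ S.c₁ * R.A j ≤ ‖fderiv ℝ v x‖) ∧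
    (∃ (x : EuclideanSpace ℝ (Fin 3)) (γ : ℝ → EuclideanSpace ℝ (Fin 3)),
      ‖x‖ ≤ r ∧ ContDiff ℝ 1 γ ∧ γ 0 = γ 1 ∧
      (∀ σ ∈ Icc (0 : ℝ) 1, γ σ ∈ Metric.closedBall x (1 / R.N j)) ∧
      (∀ σ ∈ Icc (0 : ℝ) 1, ‖deriv γ σ‖ ≤ 8 * π / R.N j) ∧
      S.c₁ * R.N j ^ (R.β - 2) ≤ circulation v γ)

variable {S}

/-- Confinement is monotone in the radius. [folklore] -/
theorem ConfinedTo.mono {r r' : ℝ} (h : S.ConfinedTo r) (hr : r ≤ r') : S.ConfinedTo r' :=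
  ⟨fun x hx => h.1 x (lt_of_le_of_lt hr hx), fun t x hx => h.2 t x (lt_of_le_of_lt hr hx)⟩

/-- A pinned schedule is confined to its own ball. [cite: Palasek2026ElementaryModel, §3.3] -/
theorem Pins.confinedTo {Λ θ : ℝ} (h : S.Pins Λ θ) : S.ConfinedTo S.radius :=
  ⟨h.datum_confined, h.force_confined⟩

/-- Reading is monotone in the radius. [folklore] -/
theorem ReadsIn.mono {j : ℕ} {r r' : ℝ} {v : EuclideanSpace ℝ (Fin 3) → EuclideanSpace ℝ (Fin 3)}
    (h : S.ReadsIn j r v) (hr : r ≤ r') : S.ReadsIn j r' v := by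
  obtain ⟨⟨x, hx, hv⟩, ⟨y, hy, hw⟩, ⟨z, γ, hz, hγ⟩⟩ := h
  exact ⟨⟨x, hx.trans hr, hv⟩, ⟨y, hy.trans hr, hw⟩, ⟨z, γ, hz.trans hr, hγ⟩⟩

/-- A read level shows its speed floor inside the ball. [folklore] -/
theorem ReadsIn.exists_speed {j : ℕ} {r : ℝ} {v : EuclideanSpace ℝ (Fin 3) → EuclideanSpace ℝ (Fin 3)}
    (h : S.ReadsIn j r v) : ∃ x, ‖x‖ ≤ r ∧ S.c₁ * R.Y j ≤ ‖v x‖ :=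
  h.1

/-- Hence: if the speed stays BELOW `c₁ Y_j` throughout `B̄(0, r)`, level `j` is not read there. [folklore] -/
theorem not_readsIn_of_speed_lt {j : ℕ} {r : ℝ} {v : EuclideanSpace ℝ (Fin 3) → EuclideanSpace ℝ (Fin 3)}
    (h : ∀ x, ‖x‖ ≤ r → ‖v x‖ < S.c₁ * R.Y j) : ¬ S.ReadsIn j r v := fun hr => by
  obtain ⟨x, hx, hge⟩ := hr.exists_speed
  exact absurd (h x hx) (not_lt.2 hge)

/-- Reading and confinement do not see the schedule's own radius: they read the same on every re-balling.
[folklore] -/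
theorem readsIn_reball_iff {r' : ℝ} {j : ℕ} {r : ℝ} {v : EuclideanSpace ℝ (Fin 3) → EuclideanSpace ℝ (Fin 3)} :
    (S.reball r').ReadsIn j r v ↔ S.ReadsIn j r v :=
  Iff.rfl

/-- **Rigidity is radius-free**: it transports to every re-balling. [folklore] -/
theorem Rigid.reball (h : S.Rigid) (r : ℝ) : (S.reball r).Rigid := ⟨h.window_eq, h.c₅_eq, h.c₁_eq, h.c₂_eq⟩

/-- **Quietness is radius-free**: it transports to every re-balling. [folklore] -/
theorem Quiet.reball (h : S.Quiet) (r : ℝ) : (S.reball r).Quiet := fun t ht => h t ht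

/-- **The pins transport to every re-balling that still CONFINES datum and force** (the impulse and separation
pins are radius-free; refuter K49 (B)). [cite: Palasek2026ElementaryModel, §3.3] -/
theorem Pins.reball {Λ θ : ℝ} (h : S.Pins Λ θ) {r : ℝ} (hc : S.ConfinedTo r) : (S.reball r).Pins Λ θ :=
  ⟨h.impulse, h.sep, hc.1, hc.2⟩

/-- In particular ENLARGING the ball is free. [folklore] -/
theorem Pins.reball_of_le {Λ θ : ℝ} (h : S.Pins Λ θ) {r : ℝ} (hr : S.radius ≤ r) : (S.reball r).Pins Λ θ :=
  h.reball (h.confinedTo.mono hr)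

end Schedule

/-! ## §2 Re-balling a globally anchored registered stage -/

namespace Stage

variable {ν : ℝ} {R : TowerRates} {S : Schedule R} {m : Margins R} {k : ℕ}

/-- **Every `routeG` stage reads its levels `j ≤ k` inside the schedule's own ball** (its floor, strain floor and
core ledger clauses, bundled). [folklore] -/
theorem readsIn_radius (s : Stage ν R S (Margins.routeG R) k) {j : ℕ} (hj : j ≤ k) :
    S.ReadsIn j S.radius (s.u (S.τ j)) :=
  ⟨s.floor j hj, s.routeG_strain j hj, s.routeG_coreLedger j hj⟩

/-- **Re-balling a `routeG` stage.** A globally anchored registered stage of `S` at level `k` whose levels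
`j ≤ k` are read inside `B̄(0, r)` is a globally anchored registered stage of `S.reball r` at level `k` — same
velocity, same pressure: the PDE, the datum, the energy, the ceilings, the quiet clauses, the global anchor and
rigidity do not see the radius. [cite: Palasek2026ElementaryModel, §3.3] -/
def reball (s : Stage ν R S (Margins.routeG R) k) (r : ℝ) (h : ∀ j, j ≤ k → S.ReadsIn j r (s.u (S.τ j))) :
    Stage ν R (S.reball r) (Margins.routeG R) k where
  u := s.u
  p := s.p
  classical := s.classical
  initial := s.initial
  energy := s.energy
  floor := fun j hj => (h j hj).1
  ceiling := s.ceiling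
  quiet := s.quiet
  margin := ⟨fun j hj => (h j hj).2.1, s.routeG_anchorGlobal, s.routeG_rigid.reball r, fun j hj => (h j hj).2.2⟩

/-- The re-balled stage has the same velocity. [folklore] -/
@[simp] theorem reball_u (s : Stage ν R S (Margins.routeG R) k) (r : ℝ)
    (h : ∀ j, j ≤ k → S.ReadsIn j r (s.u (S.τ j))) : (s.reball r h).u = s.u := rfl

/-- **Enlarging the ball is free for stages too**: a `routeG` stage of `S` is one of `S.reball r` for every
`r ≥ S.radius` (its own witnesses serve). [folklore] -/
def reballOfLe (s : Stage ν R S (Margins.routeG R) k) {r : ℝ} (hr : S.radius ≤ r) :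
    Stage ν R (S.reball r) (Margins.routeG R) k :=
  s.reball r fun _ hj => (s.readsIn_radius hj).mono hr

/-- **Un-re-balling**: a `routeG` stage of `S.reball r` with `r ≤ S.radius` is a `routeG` stage of `S` — what is
read inside `B̄(0, r)` is read inside `B̄(0, S.radius)`; same velocity and pressure. [folklore] -/
def unreball {r : ℝ} (s' : Stage ν R (S.reball r) (Margins.routeG R) k) (hr : r ≤ S.radius) :
    Stage ν R S (Margins.routeG R) k where
  u := s'.u
  p := s'.p
  classical := s'.classical
  initial := s'.initial
  energy := s'.energy
  floor := fun _ hj => ((Schedule.readsIn_reball_iff.1 (s'.readsIn_radius hj)).mono hr).1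
  ceiling := s'.ceiling
  quiet := s'.quiet
  margin :=
    ⟨fun _ hj => ((Schedule.readsIn_reball_iff.1 (s'.readsIn_radius hj)).mono hr).2.1, s'.routeG_anchorGlobal,
      ⟨s'.routeG_rigid.window_eq, s'.routeG_rigid.c₅_eq, s'.routeG_rigid.c₁_eq, s'.routeG_rigid.c₂_eq⟩,
      fun _ hj => ((Schedule.readsIn_reball_iff.1 (s'.readsIn_radius hj)).mono hr).2.2⟩

/-- The un-re-balled stage has the same velocity. [folklore] -/
@[simp] theorem unreball_u {r : ℝ} (s' : Stage ν R (S.reball r) (Margins.routeG R) k) (hr : r ≤ S.radius) :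
    (s'.unreball hr).u = s'.u := rfl

end Stage

/-! ## §3 The lever: heredity at level `k` reads level `k + 1` inside every admissible ball -/

section Lever

open Schedule

variable {k : ℕ} {S : Schedule TowerRates.wide}

/-- **`HeredityAt k` yields an extension that reads level `k + 1` inside any admissible smaller ball.** Let `S` be
pinned (`Λ = 8`, `θ = 6/5`), rigid and quiet on the wide rates, `s` a globally anchored registered stage at level
`k`, and `r ≤ S.radius` a radius such that `B̄(0, r)` confines datum and force and the levels `j ≤ k` of `s` are
read inside it. If `HeredityAt k` holds, then `s` extends to a registered level-`(k+1)` stage of `S` that reads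
level `k + 1` (speed floor `c₁ Y_{k+1}`, strain floor `c₁ A_{k+1}`, `N_{k+1}`-core loop at `τ (k+1)`) INSIDE
`B̄(0, r)` (apply the hypothesis to `S.reball r` and `s.reball r`, then un-re-ball). [cite: Palasek2026ElementaryModel, §4] -/
theorem HeredityAt.exists_extends_readsIn (h : HeredityAt k) (hP : S.Pins 8 (6 / 5)) (hR : S.Rigid) (hQ : S.Quiet)
    (s : Stage 1 TowerRates.wide S (Margins.routeG TowerRates.wide) k) {r : ℝ} (hr : r ≤ S.radius)
    (hc : S.ConfinedTo r) (hs : ∀ j, j ≤ k → S.ReadsIn j r (s.u (S.τ j))) :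
    ∃ s' : Stage 1 TowerRates.wide S (Margins.routeG TowerRates.wide) (k + 1), s.Extends s' ∧
      S.ReadsIn (k + 1) r (s'.u (S.τ (k + 1))) := by
  obtain ⟨s₂, hext⟩ := h (S.reball r) (hP.reball hc) (hR.reball r) (hQ.reball r) (s.reball r hs)
  exact ⟨s₂.unreball hr, fun t ht => hext t ht, s₂.readsIn_radius le_rfl⟩

/-- **THE BALL LEVER.** Under `HeredityAt k`: EVERY registered stage at level `k + 1` (any margins) of a pinned,
rigid, quiet wide design reads level `k + 1` at `τ (k+1)` — speed `≥ c₁ Y_{k+1}`, strain `≥ c₁ A_{k+1}`, an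
`N_{k+1}`-core loop — inside EVERY ball `B̄(0, r)`, `r ≤ S.radius`, that confines `(u₀, f)` and in which the levels
`j ≤ k` of some registered level-`k` stage of the design are read: the registered flow is unique on `[0, τ (k+1)]`
(`Stage.velocity_eq'`, no W14), so the given stage carries the velocity of the extension of
`HeredityAt.exists_extends_readsIn`. In particular level `k + 1` is read inside the SMALLEST such ball — «the
hand-over never leaves any ball that confined the design and saw the earlier levels». [cite: Sohr2001, Ch. V Thm. 1.5.1] -/
theorem HeredityAt.readsIn_reball (h : HeredityAt k) (hP : S.Pins 8 (6 / 5)) (hR : S.Rigid) (hQ : S.Quiet)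
    (s : Stage 1 TowerRates.wide S (Margins.routeG TowerRates.wide) k) {r : ℝ} (hr : r ≤ S.radius)
    (hc : S.ConfinedTo r) (hs : ∀ j, j ≤ k → S.ReadsIn j r (s.u (S.τ j)))
    {m' : Margins TowerRates.wide} (s'' : Stage 1 TowerRates.wide S m' (k + 1)) :
    S.ReadsIn (k + 1) r (s''.u (S.τ (k + 1))) := by
  obtain ⟨s', -, hread⟩ := h.exists_extends_readsIn hP hR hQ s hr hc hs
  have heq : s''.u (S.τ (k + 1)) = s'.u (S.τ (k + 1)) :=
    Stage.velocity_eq' one_pos s' s'' (S.τ (k + 1)) ⟨(S.τ_pos _).le, le_rfl⟩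
  rw [heq]
  exact hread

/-- **The lever from the level-`(k+1)` stage alone.** Under `HeredityAt k`, a registered level-`(k+1)` stage whose
OWN levels `j ≤ k` are read inside an admissible `B̄(0, r)` (`r ≤ radius`, confining `(u₀, f)`) reads level `k + 1`
inside `B̄(0, r)` too (restrict it to level `k` by `Stage.restrictOfAntitone`, then `readsIn_reball`).
[cite: Sohr2001, Ch. V Thm. 1.5.1] -/
theorem HeredityAt.readsIn_reball' (h : HeredityAt k) (hP : S.Pins 8 (6 / 5)) (hR : S.Rigid) (hQ : S.Quiet)
    (s'' : Stage 1 TowerRates.wide S (Margins.routeG TowerRates.wide) (k + 1)) {r : ℝ} (hr : r ≤ S.radius)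
    (hc : S.ConfinedTo r) (hs : ∀ j, j ≤ k → S.ReadsIn j r (s''.u (S.τ j))) :
    S.ReadsIn (k + 1) r (s''.u (S.τ (k + 1))) :=
  h.readsIn_reball hP hR hQ (Stage.restrictOfAntitone (Margins.antitone_routeG TowerRates.wide) (Nat.le_succ k) s'')
    hr hc hs s''

/-- **Heredity from `k₀` reads every level above `k₀` inside every ball that reads the levels `≤ k₀` — THE WHOLE
TOWER SITS IN THE SMALLEST ADMISSIBLE BALL OF ITS FIRST LEVELS.** Under `HeredityFrom k₀`: for every registered
stage at any level `K` of a pinned rigid quiet wide design and every `r ≤ radius` such that `B̄(0, r)` confines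
`(u₀, f)` and the levels `j ≤ k₀` are read inside it, EVERY level `j ≤ K` is read inside `B̄(0, r)` (induction on
`K` with `readsIn_reball'`). At `k₀ = 1` (`EpisodeInductionG`): every ball that confines the design and reads levels
`0` and `1` reads the whole tower. [cite: Sohr2001, Ch. V Thm. 1.5.1] -/
theorem HeredityFrom.readsIn_all {k₀ : ℕ} (h : HeredityFrom k₀) (hP : S.Pins 8 (6 / 5)) (hR : S.Rigid)
    (hQ : S.Quiet) {K : ℕ} (s : Stage 1 TowerRates.wide S (Margins.routeG TowerRates.wide) K) {r : ℝ}
    (hr : r ≤ S.radius) (hc : S.ConfinedTo r) (hs : ∀ j, j ≤ k₀ → j ≤ K → S.ReadsIn j r (s.u (S.τ j))) :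
    ∀ j, j ≤ K → S.ReadsIn j r (s.u (S.τ j)) := by
  induction K with
  | zero =>
    intro j hj
    exact hs j ((Nat.le_zero.1 hj).symm ▸ Nat.zero_le _) hj
  | succ K ih =>
    -- the restriction of `s` to level `K` reads every level `≤ K` inside the ball (induction hypothesis)
    set sK := Stage.restrictOfAntitone (Margins.antitone_routeG TowerRates.wide) (Nat.le_succ K) s with hsK
    have huK : sK.u = s.u := Stage.restrictOfAntitone_u _ _ _
    have hK : ∀ j, j ≤ K → S.ReadsIn j r (s.u (S.τ j)) := by
      have := ih sK (fun j hj hjK => by rw [huK]; exact hs j hj (hjK.trans (Nat.le_succ K)))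
      simpa only [huK] using this
    intro j hj
    rcases Nat.lt_or_ge j (K + 1) with hlt | hge
    · exact hK j (Nat.lt_succ_iff.1 hlt)
    · have hjK : j = K + 1 := le_antisymm hj hge
      subst hjK
      rcases Nat.lt_or_ge K k₀ with hK₀ | hK₀
      · exact hs (K + 1) hK₀ le_rfl
      · exact (h.heredityAt hK₀).readsIn_reball' hP hR hQ s hr hc hK

end Lever

/-! ## §4 Refutation templates: one registered stage whose next readout escapes an admissible ball -/

section Templates

open Schedule

variable {k : ℕ} {S : Schedule TowerRates.wide}

/-- **TEMPLATE (stage form).** ONE pinned rigid quiet wide design, ONE registered level-`k` stage `s` of it, ONE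
admissible radius `r ≤ radius` (confining `(u₀, f)`, reading the levels `j ≤ k` of `s`) such that NO registered
level-`(k+1)` extension of `s` reads level `k + 1` inside `B̄(0, r)` — refutes `HeredityAt k`. (Vacuity warning:
the premise is a REGISTERED stage; none is known.) [cite: Palasek2026ElementaryModel, §4] -/
theorem not_heredityAt_of_not_readsIn (hP : S.Pins 8 (6 / 5)) (hR : S.Rigid) (hQ : S.Quiet)
    (s : Stage 1 TowerRates.wide S (Margins.routeG TowerRates.wide) k) {r : ℝ} (hr : r ≤ S.radius)
    (hc : S.ConfinedTo r) (hs : ∀ j, j ≤ k → S.ReadsIn j r (s.u (S.τ j)))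
    (hesc : ∀ s' : Stage 1 TowerRates.wide S (Margins.routeG TowerRates.wide) (k + 1), s.Extends s' →
      ¬ S.ReadsIn (k + 1) r (s'.u (S.τ (k + 1)))) :
    ¬ HeredityAt k := fun h => by
  obtain ⟨s', hext, hread⟩ := h.exists_extends_readsIn hP hR hQ s hr hc hs
  exact hesc s' hext hread

/-- **TEMPLATE (speed form).** If every registered level-`(k+1)` extension of `s` has speed `< c₁ Y_{k+1}`
throughout `B̄(0, r)` at `τ (k+1)` (admissible `r` as above), then `HeredityAt k` fails.
[cite: Palasek2026ElementaryModel, §4] -/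
theorem not_heredityAt_of_speed_lt (hP : S.Pins 8 (6 / 5)) (hR : S.Rigid) (hQ : S.Quiet)
    (s : Stage 1 TowerRates.wide S (Margins.routeG TowerRates.wide) k) {r : ℝ} (hr : r ≤ S.radius)
    (hc : S.ConfinedTo r) (hs : ∀ j, j ≤ k → S.ReadsIn j r (s.u (S.τ j)))
    (hesc : ∀ s' : Stage 1 TowerRates.wide S (Margins.routeG TowerRates.wide) (k + 1), s.Extends s' →
      ∀ x, ‖x‖ ≤ r → ‖s'.u (S.τ (k + 1)) x‖ < S.c₁ * TowerRates.wide.Y (k + 1)) :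
    ¬ HeredityAt k :=
  not_heredityAt_of_not_readsIn hP hR hQ s hr hc hs fun s' hext => not_readsIn_of_speed_lt (hesc s' hext)

/-- **TEMPLATE (plain-continuation form — compute the design's flow).** ONE pinned rigid quiet wide design, ONE
registered level-`k` stage `s`, ONE admissible radius `r ≤ radius`, and ONE classical finite-energy solution
`(v, q)` of the design's system on `[0, τ (k+1)]` from the Clay datum (ANY such: it is the registered flow by
`Stage.velocity_eq_of_classical` — no W14, no ceiling asked) whose speed at `τ (k+1)` stays `< c₁ Y_{k+1}`
throughout `B̄(0, r)` — refutes `HeredityAt k`. [cite: Sohr2001, Ch. V Thm. 1.5.1] -/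
theorem not_heredityAt_of_continuation_speed_lt (hP : S.Pins 8 (6 / 5)) (hR : S.Rigid) (hQ : S.Quiet)
    (s : Stage 1 TowerRates.wide S (Margins.routeG TowerRates.wide) k) {r : ℝ} (hr : r ≤ S.radius)
    (hc : S.ConfinedTo r) (hs : ∀ j, j ≤ k → S.ReadsIn j r (s.u (S.τ j)))
    {v : ℝ → EuclideanSpace ℝ (Fin 3) → EuclideanSpace ℝ (Fin 3)} {q : ℝ → EuclideanSpace ℝ (Fin 3) → ℝ}
    (hv : IsClassicalNSSolutionOn (Icc 0 (S.τ (k + 1))) 1 S.f v q) (hv0 : v 0 = S.u₀)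
    (hEv : ∃ C : ℝ≥0∞, C < ⊤ ∧ ∀ t ∈ Icc 0 (S.τ (k + 1)), ∫⁻ x, ‖v t x‖ₑ ^ 2 ≤ C)
    (hesc : ∀ x, ‖x‖ ≤ r → ‖v (S.τ (k + 1)) x‖ < S.c₁ * TowerRates.wide.Y (k + 1)) :
    ¬ HeredityAt k := fun h => by
  obtain ⟨s', -, hread⟩ := h.exists_extends_readsIn hP hR hQ s hr hc hs
  have heq : v (S.τ (k + 1)) = s'.u (S.τ (k + 1)) :=
    s'.velocity_eq_of_classical one_pos le_rfl hv hv0 hEv (S.τ (k + 1)) ⟨(S.τ_pos _).le, le_rfl⟩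
  rw [← heq] at hread
  exact not_readsIn_of_speed_lt hesc hread

end Templates

/-! ## §5 The lever on the lower stub `ReadoutFloorsAt k` -/

section LowerStub

open Schedule

variable {k : ℕ} {S : Schedule TowerRates.wide}

/-- **The lower stub re-balled.** `ReadoutFloorsAt k` (conclusion: three witnesses with `‖x‖ ≤ S.radius`) applied
to `S.reball r` / `s.reball r`: for every admissible `r` (confining `(u₀, f)`, reading the levels `j ≤ k` of `s`;
no comparison with `S.radius` needed) and every finite-energy classical continuation of `s` to `τ (k+1)` inside the
ceiling, level `k + 1` is read inside `B̄(0, r)`. [cite: Palasek2026ElementaryModel, §4] -/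
theorem ReadoutFloorsAt.readsIn_reball (h : ReadoutFloorsAt k) (hP : S.Pins 8 (6 / 5)) (hR : S.Rigid)
    (hQ : S.Quiet) (s : Stage 1 TowerRates.wide S (Margins.routeG TowerRates.wide) k) {r : ℝ}
    (hc : S.ConfinedTo r) (hs : ∀ j, j ≤ k → S.ReadsIn j r (s.u (S.τ j)))
    {u : ℝ → EuclideanSpace ℝ (Fin 3) → EuclideanSpace ℝ (Fin 3)} {p : ℝ → EuclideanSpace ℝ (Fin 3) → ℝ}
    (hcl : IsClassicalNSSolutionOn (Icc 0 (S.τ (k + 1))) 1 S.f u p)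
    (hagree : ∀ t ∈ Icc 0 (S.τ k), u t = s.u t ∧ p t = s.p t)
    (henergy : ∃ C : ℝ≥0∞, C < ⊤ ∧ ∀ t ∈ Icc 0 (S.τ (k + 1)), ∫⁻ x, ‖u t x‖ₑ ^ 2 ≤ C)
    (hceil : ∀ t ∈ Icc 0 (S.τ (k + 1)), ∀ x, ‖u t x‖ ≤ S.c₂ * TowerRates.wide.Y (k + 1)) :
    S.ReadsIn (k + 1) r (u (S.τ (k + 1))) :=
  h (S.reball r) (hP.reball hc) (hR.reball r) (hQ.reball r) (s.reball r hs) u p hcl hagree henergy hceil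

/-- **TEMPLATE for the lower stub.** ONE registered level-`k` stage, ONE admissible radius `r`, ONE finite-energy
classical continuation inside the ceiling whose speed at `τ (k+1)` stays `< c₁ Y_{k+1}` throughout `B̄(0, r)` —
refutes `ReadoutFloorsAt k` (at `k = 1`: the registered stub `stub_readout_floors_one` of item 19249).
[cite: Palasek2026ElementaryModel, §4] -/
theorem not_readoutFloorsAt_of_continuation_speed_lt (hP : S.Pins 8 (6 / 5)) (hR : S.Rigid) (hQ : S.Quiet)
    (s : Stage 1 TowerRates.wide S (Margins.routeG TowerRates.wide) k) {r : ℝ}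
    (hc : S.ConfinedTo r) (hs : ∀ j, j ≤ k → S.ReadsIn j r (s.u (S.τ j)))
    {u : ℝ → EuclideanSpace ℝ (Fin 3) → EuclideanSpace ℝ (Fin 3)} {p : ℝ → EuclideanSpace ℝ (Fin 3) → ℝ}
    (hcl : IsClassicalNSSolutionOn (Icc 0 (S.τ (k + 1))) 1 S.f u p)
    (hagree : ∀ t ∈ Icc 0 (S.τ k), u t = s.u t ∧ p t = s.p t)
    (henergy : ∃ C : ℝ≥0∞, C < ⊤ ∧ ∀ t ∈ Icc 0 (S.τ (k + 1)), ∫⁻ x, ‖u t x‖ₑ ^ 2 ≤ C)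
    (hceil : ∀ t ∈ Icc 0 (S.τ (k + 1)), ∀ x, ‖u t x‖ ≤ S.c₂ * TowerRates.wide.Y (k + 1))
    (hesc : ∀ x, ‖x‖ ≤ r → ‖u (S.τ (k + 1)) x‖ < S.c₁ * TowerRates.wide.Y (k + 1)) :
    ¬ ReadoutFloorsAt k := fun h =>
  not_readsIn_of_speed_lt hesc (h.readsIn_reball hP hR hQ s hc hs hcl hagree henergy hceil)

end LowerStub

end Summit.NavierStokesRegularity.FluidComputer.PalasekTowerClayBridge

end
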